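import Literature.AnabelianGeometry.SemiGraphs.ArithThm54CapstoneCorollary
import Literature.AnabelianGeometry.SemiGraphs.ArithLevelKerCongruence
import Literature.AnabelianGeometry.SemiGraphs.TemperedPiEdgeGroupsInfVerticial
import HarnessLib

/-!
# [SemiAnbd] Prop 5.2 (i)/(iv) / Thm 5.4 producer T54-B — the continuity binder `hK1′` at the TREE levels
# REDUCED to congruence-continuity of the outer action: tree levels of a graph are simple (proof-only)

Mochizuki, *Semi-graphs of anabelioids*, Publ. RIMS **42** (2006) 221–322, §5: Def 5.1 (i)(c)/(d) p. 62,
Prop 5.2 (i) p. 63 ("every tempered covering of `𝒢` appears as the geometric component of a tempered covering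
of `𝔊`"), Prop 5.2 (iv) p. 64; §3 proof of Thm 3.7 (iii) p. 41 (the trees `𝒢_{∞,i}`)
[cite: MochizukiSemiAnbd2006, Prop 5.2 (iv), p. 64].

PROOF-ONLY file (abc-iut cell, layer L3, sub-DAG `plan/L3/SUBDAG-SemiAnbd-Thm54.md`, producer row T54-B =
`plan/GAP-LEDGER.md` G-w4d053-1, residual binder «T54·hK1′», piece (S4) of abc-iut-w6-d117 gen 2's SHAPES
2026-08-26T10:19Z; class DESIGN confirmed by abc-iut-w4-d053 g4 10:21:34Z: «(S4) … honest label "reduction, owes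
hself at deep tree levels"; hsimple at tree levels: OK via treeCosetIso»).  No definition, no new named fact.

abc-iut-L3-d2's `ArithLevelKerCongruence.isOpen_map_levelKer_of_congruent_lifts_of_simple` reduces the
capstone binder `hK1′ : IsOpen (aug (levelKer L))` at a level `L` to the CONGRUENCE-CONTINUITY of the outer
action at `L` («every `a` near `1` in `Π_A` has a representative `φ ≡ id (mod L)` with trivial base action»),
given two structural inputs on the level-`L` coset semi-graph: `hsimple` (an edge is determined by the vertices
its branches abut to) and `hself` (the images of the vertex groups `H_w` in `Γ ⧸ L` are self-normalising).
The capstone's `hK1′` quantifies over the TREE levels `L = ker ρ_n` of the canonical tower.  Here: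

* §1 `SubgroupPresentation.eMk_eq_of_vMk_eq_of_isTree` — **tree levels of a GRAPH are simple**: if the
  level-`K` coset semi-graph is a tree and every branch of `𝔾` abuts (`IsGraph`), then `hsimple` holds at
  `K`: the two edges `M_ε y₁ K`, `M_ε y₂ K` over `ε` whose branches abut to the same vertices have the same two
  DISTINCT ends (abc-iut-w4-d059/abc-iut-w4-d085's `vMk_s_mul_ne_of_isTree`: no loops in a tree), hence
  coincide (abc-iut-w4-d085's `SemiGraph.edgeOf_eq_of_isAcyclic`: no double edges in a tree);
* §2 `SubgroupPresentation.isOpen_map_levelKer_of_congruent_lifts_of_isTree` — abc-iut-L3-d2's reduction with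
  `hsimple` DISCHARGED at tree levels of a graph: `hK1′` at `L` ⟸ `hself` at `L` ∧ congruence-continuity at `L`;
* §3 at the canonical tower `𝒢.galoisLevelData h36` of the outer model `π₁^temp(𝒢) ⋊^out_{ρ'} Π_A` (the
  capstone's currency, any `T R hP hLst`): `piPresentation_hsimple` (no hypothesis), and the binder VERBATIM —
  `hK1'_of_congruenceContinuous_of_hself` (level by level) and `hK1'_of_eventually_congruenceContinuous_of_hself`
  (it suffices at all DEEP levels `n ≥ n₀`, by antitonicity: abc-iut-L3-d2's `isOpen_map_of_frequently`).

HONEST LABEL.  This is a REDUCTION: at genuine (infinite-monodromy) data `hK1′` becomes print's Def 5.1 (i)(c)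
+ Prop 5.2 (i) in the form «`ρ'` congruence-continuous at the deep tree levels, trivial base action nearby»
(binder `hCC`, DESIGN) plus «vertex-group images self-normalising in `Gal(𝒢_{∞,n}/𝒢)` at deep levels» (binder
`hself`, expected to follow from total elevation + compactness of the vertex groups + cofinality of the tower —
NOT proved here; it FAILS at shallow levels, e.g. at `n = 0` when `𝒢_{∞,0}` is the universal graph-covering
with trivial vertex images).  The finite-monodromy regime (open `ker ρ' ⊓ ker baseAct`) needs neither
(abc-iut-w6-d117's `ArithLevelKerOpenOfFiniteMonodromy`).  Nothing here refers to the IUT corpus; no side is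
taken on [IUTchIII] Cor. 3.12; typed ≠ proved for the residual inputs.
-/

namespace Literature.AnabelianGeometry.SemiGraphs

open CategoryTheory Topology Filter
open Literature.AnabelianGeometry.EtaleTheta

universe u v w

/-! ### §1 Tree levels of a graph are simple coset semi-graphs -/

namespace SemiGraph

namespace SubgroupPresentation

variable {𝔾 : SemiGraph.{u}} {Γ : Type u} [Group Γ] (P : SubgroupPresentation 𝔾 Γ)

/-- **Tree levels of a graph are simple**: if the level-`K` coset semi-graph `P.cosetGraph K` is a TREE and
every branch of `𝔾` abuts to a vertex, then an edge of `P.cosetGraph K` over `ε` is determined by the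
vertices its branches abut to — the input `hsimple` of abc-iut-L3-d2's `arithAct_eq_one_of_congruent_of_simple`.
Proof: the two branches `b ≠ b'` of `ε` give the two ends `H_w s_b yᵢ K ≠ H_{w'} s_{b'} yᵢ K` of `M_ε yᵢ K`
(`vMk_s_mul_ne_of_isTree`, no loops); two edges of a tree with the same two distinct ends coincide
(`SemiGraph.edgeOf_eq_of_isAcyclic`, no double edges). [cite: MochizukiSemiAnbd2006, Thm 3.7 (iii), p. 41] -/
theorem eMk_eq_of_vMk_eq_of_isTree (K : Subgroup Γ) (hT : (P.cosetGraph K).IsTree) (hG : 𝔾.IsGraph)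
    (ε : 𝔾.Edge) (y₁ y₂ : Γ)
    (h : ∀ (b : 𝔾.Branch) (w : 𝔾.Vertex), 𝔾.edgeOf b = ε → 𝔾.abuts b = some w →
      P.vMk K w (P.s b * y₁) = P.vMk K w (P.s b * y₂)) :
    P.eMk K ε y₁ = P.eMk K ε y₂ := by
  obtain ⟨b, b', hbb', hb, hb', -⟩ := 𝔾.two_branches ε
  obtain ⟨w, hw⟩ := Option.isSome_iff_exists.mp (hG.abuts_isSome b)
  obtain ⟨w', hw'⟩ := Option.isSome_iff_exists.mp (hG.abuts_isSome b')
  -- the two ends of `M_ε y₁ K` are distinct (no loops in a tree)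
  have hvu : P.vMk K w (P.s b * y₁) ≠ P.vMk K w' (P.s b' * y₁) :=
    P.vMk_s_mul_ne_of_isTree K hT hbb' (hb.trans hb'.symm) hw hw' y₁
  -- no double edges in a tree
  have key : (P.cosetGraph K).edgeOf (P.bMk K b y₁) = (P.cosetGraph K).edgeOf (P.bMk K b y₂) :=
    SemiGraph.edgeOf_eq_of_isAcyclic (G := P.cosetGraph K) hT.isTree.isAcyclic
      (b₁ := P.bMk K b y₁) (c₁ := P.bMk K b' y₁) (b₂ := P.bMk K b y₂) (c₂ := P.bMk K b' y₂) hvu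
      (by change P.eMk K (𝔾.edgeOf b') y₁ = P.eMk K (𝔾.edgeOf b) y₁; rw [hb, hb'])
      (by change P.eMk K (𝔾.edgeOf b') y₂ = P.eMk K (𝔾.edgeOf b) y₂; rw [hb, hb'])
      (P.cosetGraph_abuts_bMk K b w hw y₁) (P.cosetGraph_abuts_bMk K b' w' hw' y₁)
      (by rw [h b w hb hw]; exact P.cosetGraph_abuts_bMk K b w hw y₂)
      (by rw [h b' w' hb' hw']; exact P.cosetGraph_abuts_bMk K b' w' hw' y₂)
  change P.eMk K (𝔾.edgeOf b) y₁ = P.eMk K (𝔾.edgeOf b) y₂ at key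
  rw [hb] at key
  exact key

/-- `hsimple` at a tree level of a graph, in the exact binder form of abc-iut-L3-d2's
`arithAct_eq_one_of_congruent_of_simple` / `isOpen_map_levelKer_of_congruent_lifts_of_simple`.
[cite: MochizukiSemiAnbd2006, Thm 3.7 (iii), p. 41] -/
theorem hsimple_of_isTree (K : Subgroup Γ) (hT : (P.cosetGraph K).IsTree) (hG : 𝔾.IsGraph) :
    ∀ (ε : 𝔾.Edge) (y₁ y₂ : Γ),
      (∀ (b : 𝔾.Branch) (w : 𝔾.Vertex), 𝔾.edgeOf b = ε → 𝔾.abuts b = some w →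
        P.vMk K w (P.s b * y₁) = P.vMk K w (P.s b * y₂)) → P.eMk K ε y₁ = P.eMk K ε y₂ :=
  fun ε y₁ y₂ h => P.eMk_eq_of_vMk_eq_of_isTree K hT hG ε y₁ y₂ h

/-! ### §2 abc-iut-L3-d2's reduction with `hsimple` discharged at tree levels -/

variable {E : Type v} [Group E] {Φ : E →* MulAut Γ} {σ : E →* Aut 𝔾} (hP : P.IsArithCompatible Φ σ)
  (L : Subgroup Γ) (hL : ∀ (e : E) (x : Γ), x ∈ L → Φ e x ∈ L)

/-- **At a tree level of a graph, an element with trivial base action, congruent to the identity modulo the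
level, acts trivially** — given self-normalising vertex images (`hself`): abc-iut-L3-d2's
`arithAct_eq_one_of_congruent_of_simple` with `hsimple := hsimple_of_isTree`.
[cite: MochizukiSemiAnbd2006, Prop 5.2 (i), p. 63] -/
theorem arithAct_eq_one_of_congruent_of_isTree [L.Normal] (hT : (P.cosetGraph L).IsTree) (hG : 𝔾.IsGraph)
    (hself : ∀ (w : 𝔾.Vertex) (q : Γ ⧸ L),
      (∀ x : Γ ⧸ L, x ∈ (P.H w).map (QuotientGroup.mk' L) ↔
        q⁻¹ * x * q ∈ (P.H w).map (QuotientGroup.mk' L)) →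
      q ∈ (P.H w).map (QuotientGroup.mk' L))
    {e : E} (hσ : σ e = 1) (hcong : ∀ y : Γ, Φ e y * y⁻¹ ∈ L) : P.arithAct hP L hL e = 1 :=
  P.arithAct_eq_one_of_congruent_of_simple hP L hL hσ hcong hself (P.hsimple_of_isTree L hT hG)

/-- **`hK1′` at a tree level of a graph ⟸ `hself` ∧ congruence-continuity at the level**: abc-iut-L3-d2's
`isOpen_map_levelKer_of_congruent_lifts_of_simple` with `hsimple` DISCHARGED by `hsimple_of_isTree`.
[cite: MochizukiSemiAnbd2006, Prop 5.2 (iv), p. 64] -/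
theorem isOpen_map_levelKer_of_congruent_lifts_of_isTree [L.Normal] {A : Type w} [Group A]
    [TopologicalSpace A] [ContinuousMul A] (aug : E →* A) (hT : (P.cosetGraph L).IsTree) (hG : 𝔾.IsGraph)
    (hself : ∀ (w : 𝔾.Vertex) (q : Γ ⧸ L),
      (∀ x : Γ ⧸ L, x ∈ (P.H w).map (QuotientGroup.mk' L) ↔
        q⁻¹ * x * q ∈ (P.H w).map (QuotientGroup.mk' L)) →
      q ∈ (P.H w).map (QuotientGroup.mk' L))
    {U : Set A} (hU : U ∈ 𝓝 (1 : A))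
    (hlift : ∀ a ∈ U, ∃ e : E, aug e = a ∧ σ e = 1 ∧ ∀ y : Γ, Φ e y * y⁻¹ ∈ L) :
    IsOpen (((P.levelKer hP L hL).map aug : Subgroup A) : Set A) :=
  P.isOpen_map_levelKer_of_congruent_lifts_of_simple hP L hL aug hself (P.hsimple_of_isTree L hT hG) hU hlift

end SubgroupPresentation

end SemiGraph

/-! ### §3 At the outer model over a chart, and the capstone binder VERBATIM at the canonical tower -/

namespace ProfiniteSemiGraph

variable {𝒢 : ProfiniteSemiGraph.{u}} (c : TemperedPiChart 𝒢) {PA : Type w} [Group PA] [TopologicalSpace PA]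
  [ContinuousMul PA] (ρ : PA →* TopOut c.G) (baseAct : PA →* Aut 𝒢.graph)
  (P : SemiGraph.SubgroupPresentation 𝒢.graph c.G)
  (hP : P.IsArithCompatible
    (((contMulAut c.G).subtype.comp (MonoidHom.fst (contMulAut c.G) PA)).comp (outerSemidirectProduct ρ).subtype)
    (baseAct.comp (outerSemidirectProductSnd ρ)))
  (L : Subgroup c.G)
  (hL : ∀ (e : outerSemidirectProduct ρ) (x : c.G), x ∈ L →
    (((contMulAut c.G).subtype.comp (MonoidHom.fst (contMulAut c.G) PA)).comp (outerSemidirectProduct ρ).subtype)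
      e x ∈ L)

/-- **`hK1′` at a tree level of the outer model `π₁^temp(𝒢) ⋊^out_ρ Π_A` over a chart ⟸ `hself` ∧
congruence-continuity of `ρ` at the level** («every `a` in some neighbourhood of `1` in `Π_A` has a
representative `φ` of `ρ a`, bi-continuous, with `φ(y) y⁻¹ ∈ L` for all `y`, and acts trivially on `𝔾`» —
Def 5.1 (i)(c)/(d) at the level, the DESIGN binder `hCC`), for a GRAPH `𝔾` (every branch abuts).
[cite: MochizukiSemiAnbd2006, Prop 5.2 (iv), p. 64] -/
theorem isOpen_map_levelKer_outerSemidirectProductSnd_of_congruenceContinuous (hLn : L.Normal)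
    (hT : (P.cosetGraph L).IsTree) (hG : 𝒢.graph.IsGraph)
    (hself : ∀ (w : 𝒢.graph.Vertex) (q : c.G ⧸ L),
      (∀ x : c.G ⧸ L, x ∈ (P.H w).map (QuotientGroup.mk' L) ↔
        q⁻¹ * x * q ∈ (P.H w).map (QuotientGroup.mk' L)) →
      q ∈ (P.H w).map (QuotientGroup.mk' L))
    (hCC : ∃ U ∈ 𝓝 (1 : PA), ∀ a ∈ U, baseAct a = 1 ∧
      ∃ φ : contMulAut c.G, TopOut.mk c.G φ = ρ a ∧ ∀ y : c.G, (φ : MulAut c.G) y * y⁻¹ ∈ L) :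
    IsOpen (((P.levelKer hP L hL).map (outerSemidirectProductSnd ρ) : Subgroup PA) : Set PA) := by
  haveI := hLn
  obtain ⟨U, hU, hUcc⟩ := hCC
  refine P.isOpen_map_levelKer_of_congruent_lifts_of_isTree hP L hL (outerSemidirectProductSnd ρ) hT hG hself
    hU fun a ha => ?_
  obtain ⟨hσ, φ, hφ, hcong⟩ := hUcc a ha
  refine ⟨⟨(φ, a), hφ⟩, rfl, ?_, fun y => hcong y⟩
  change baseAct (outerSemidirectProductSnd ρ _) = 1
  exact hσ

/-- **`hsimple` at the tree levels of the canonical tower, no hypothesis** (for a graph `𝔾`): the coset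
semi-graph of abc-iut-L3-d4's presentation at `ker ρ_n` is the tree `𝒢_{∞,n}` (`piPresentation_hT`).
[cite: MochizukiSemiAnbd2006, Thm 3.7 (iii), p. 41] -/
theorem piPresentation_hsimple (h36 : 𝒢.Prop36Hypotheses) (hG : 𝒢.graph.IsGraph)
    (T : ∀ w : 𝒢.graph.Vertex, (𝒢.galoisLevelData h36).PointSeq h36.isCountable w)
    (R : SemiGraph.RefBranches 𝒢.graph) (n : ℕ) :
    ∀ (ε : 𝒢.graph.Edge) (y₁ y₂ : (𝒢.galoisLevelData h36).temperedPi h36.isCountable),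
      (∀ (b : 𝒢.graph.Branch) (w : 𝒢.graph.Vertex), 𝒢.graph.edgeOf b = ε → 𝒢.graph.abuts b = some w →
        ((𝒢.galoisLevelData h36).piPresentation h36.isCountable T R).vMk ((𝒢.galoisLevelData h36).projAut h36.isCountable n).ker w
          (((𝒢.galoisLevelData h36).piPresentation h36.isCountable T R).s b * y₁) =
        ((𝒢.galoisLevelData h36).piPresentation h36.isCountable T R).vMk ((𝒢.galoisLevelData h36).projAut h36.isCountable n).ker w
          (((𝒢.galoisLevelData h36).piPresentation h36.isCountable T R).s b * y₂)) →
      ((𝒢.galoisLevelData h36).piPresentation h36.isCountable T R).eMk ((𝒢.galoisLevelData h36).projAut h36.isCountable n).ker ε y₁ =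
        ((𝒢.galoisLevelData h36).piPresentation h36.isCountable T R).eMk ((𝒢.galoisLevelData h36).projAut h36.isCountable n).ker ε y₂ :=
  ((𝒢.galoisLevelData h36).piPresentation h36.isCountable T R).hsimple_of_isTree _
    ((𝒢.galoisLevelData h36).piPresentation_hT h36.isCountable T R n) hG

/-- **The capstone binder `hK1′` at ONE tree level `n` of the canonical tower ⟸ `hself n` ∧ `hCC n`**
(congruence-continuity of `ρ'` at `ker ρ_n` with trivial base action nearby); `hsimple` is a theorem there.
[cite: MochizukiSemiAnbd2006, Prop 5.2 (iv), p. 64] -/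
theorem hK1'_at_of_congruenceContinuous_of_hself (h36 : 𝒢.Prop36Hypotheses) (hG : 𝒢.graph.IsGraph)
    {PA : Type w} [Group PA] [TopologicalSpace PA] [ContinuousMul PA]
    (ρ' : PA →* TopOut (𝒢.temperedPiChart h36).G) (baseAct : PA →* Aut 𝒢.graph)
    (T : ∀ w : 𝒢.graph.Vertex, (𝒢.galoisLevelData h36).PointSeq h36.isCountable w)
    (R : SemiGraph.RefBranches 𝒢.graph)
    (hP : ((𝒢.galoisLevelData h36).piPresentation h36.isCountable T R).IsArithCompatible
      (((contMulAut (𝒢.temperedPiChart h36).G).subtype.comp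
        (MonoidHom.fst (contMulAut (𝒢.temperedPiChart h36).G) PA)).comp (outerSemidirectProduct ρ').subtype)
      (baseAct.comp (outerSemidirectProductSnd ρ')))
    (hLst : ∀ (n : ℕ) (e : outerSemidirectProduct ρ') (x : (𝒢.temperedPiChart h36).G),
      x ∈ ((𝒢.galoisLevelData h36).piLevelAut h36.isCountable (𝒢.galoisLevelData_hconn h36) n).ker →
        (((contMulAut (𝒢.temperedPiChart h36).G).subtype.comp
          (MonoidHom.fst (contMulAut (𝒢.temperedPiChart h36).G) PA)).comp (outerSemidirectProduct ρ').subtype)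
          e x ∈ ((𝒢.galoisLevelData h36).piLevelAut h36.isCountable (𝒢.galoisLevelData_hconn h36) n).ker)
    (n : ℕ)
    (hself : ∀ (w : 𝒢.graph.Vertex) (q : (𝒢.temperedPiChart h36).G ⧸ ((𝒢.galoisLevelData h36).projAut h36.isCountable n).ker),
      (∀ x : (𝒢.temperedPiChart h36).G ⧸ ((𝒢.galoisLevelData h36).projAut h36.isCountable n).ker,
        x ∈ (((𝒢.galoisLevelData h36).piPresentation h36.isCountable T R).H w).map (QuotientGroup.mk' _) ↔
        q⁻¹ * x * q ∈ (((𝒢.galoisLevelData h36).piPresentation h36.isCountable T R).H w).map (QuotientGroup.mk' _)) →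
      q ∈ (((𝒢.galoisLevelData h36).piPresentation h36.isCountable T R).H w).map (QuotientGroup.mk' _))
    (hCC : ∃ U ∈ 𝓝 (1 : PA), ∀ a ∈ U, baseAct a = 1 ∧
      ∃ φ : contMulAut (𝒢.temperedPiChart h36).G, TopOut.mk (𝒢.temperedPiChart h36).G φ = ρ' a ∧
        ∀ y : (𝒢.temperedPiChart h36).G, (φ : MulAut (𝒢.temperedPiChart h36).G) y * y⁻¹ ∈
          ((𝒢.galoisLevelData h36).projAut h36.isCountable n).ker) :
    IsOpen (((((𝒢.galoisLevelData h36).piPresentation h36.isCountable T R).levelKer hP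
        ((𝒢.galoisLevelData h36).projAut h36.isCountable n).ker
        ((𝒢.galoisLevelData h36).hKst_of_hLst_outerAction h36.isCountable (𝒢.galoisLevelData_hconn h36)
          T R ρ' hP hLst n)).map (outerSemidirectProductSnd ρ') : Subgroup PA) : Set PA) :=
  isOpen_map_levelKer_outerSemidirectProductSnd_of_congruenceContinuous (𝒢.temperedPiChart h36) ρ' baseAct _
    hP _ _ (MonoidHom.normal_ker _) ((𝒢.galoisLevelData h36).piPresentation_hT h36.isCountable T R n) hG
    hself hCC

/-- **The capstone binder `hK1′` (ALL tree levels) ⟸ `hself` and congruence-continuity at all DEEP levels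
`n ≥ n₀`**: the arithmetic level kernels are antitone in the level (abc-iut-L3-d4's `levelKer_mono`,
`ker_projAut_anti`), so openness of their images at deep levels gives it everywhere (abc-iut-L3-d2's
`isOpen_map_of_frequently`). [cite: MochizukiSemiAnbd2006, Prop 5.2 (iv), p. 64] -/
theorem hK1'_of_eventually_congruenceContinuous_of_hself (h36 : 𝒢.Prop36Hypotheses) (hG : 𝒢.graph.IsGraph)
    {PA : Type w} [Group PA] [TopologicalSpace PA] [ContinuousMul PA]
    (ρ' : PA →* TopOut (𝒢.temperedPiChart h36).G) (baseAct : PA →* Aut 𝒢.graph)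
    (T : ∀ w : 𝒢.graph.Vertex, (𝒢.galoisLevelData h36).PointSeq h36.isCountable w)
    (R : SemiGraph.RefBranches 𝒢.graph)
    (hP : ((𝒢.galoisLevelData h36).piPresentation h36.isCountable T R).IsArithCompatible
      (((contMulAut (𝒢.temperedPiChart h36).G).subtype.comp
        (MonoidHom.fst (contMulAut (𝒢.temperedPiChart h36).G) PA)).comp (outerSemidirectProduct ρ').subtype)
      (baseAct.comp (outerSemidirectProductSnd ρ')))
    (hLst : ∀ (n : ℕ) (e : outerSemidirectProduct ρ') (x : (𝒢.temperedPiChart h36).G),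
      x ∈ ((𝒢.galoisLevelData h36).piLevelAut h36.isCountable (𝒢.galoisLevelData_hconn h36) n).ker →
        (((contMulAut (𝒢.temperedPiChart h36).G).subtype.comp
          (MonoidHom.fst (contMulAut (𝒢.temperedPiChart h36).G) PA)).comp (outerSemidirectProduct ρ').subtype)
          e x ∈ ((𝒢.galoisLevelData h36).piLevelAut h36.isCountable (𝒢.galoisLevelData_hconn h36) n).ker)
    (n₀ : ℕ)
    (hself : ∀ n, n₀ ≤ n → ∀ (w : 𝒢.graph.Vertex)
      (q : (𝒢.temperedPiChart h36).G ⧸ ((𝒢.galoisLevelData h36).projAut h36.isCountable n).ker),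
      (∀ x : (𝒢.temperedPiChart h36).G ⧸ ((𝒢.galoisLevelData h36).projAut h36.isCountable n).ker,
        x ∈ (((𝒢.galoisLevelData h36).piPresentation h36.isCountable T R).H w).map (QuotientGroup.mk' _) ↔
        q⁻¹ * x * q ∈ (((𝒢.galoisLevelData h36).piPresentation h36.isCountable T R).H w).map (QuotientGroup.mk' _)) →
      q ∈ (((𝒢.galoisLevelData h36).piPresentation h36.isCountable T R).H w).map (QuotientGroup.mk' _))
    (hCC : ∀ n, n₀ ≤ n → ∃ U ∈ 𝓝 (1 : PA), ∀ a ∈ U, baseAct a = 1 ∧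
      ∃ φ : contMulAut (𝒢.temperedPiChart h36).G, TopOut.mk (𝒢.temperedPiChart h36).G φ = ρ' a ∧
        ∀ y : (𝒢.temperedPiChart h36).G, (φ : MulAut (𝒢.temperedPiChart h36).G) y * y⁻¹ ∈
          ((𝒢.galoisLevelData h36).projAut h36.isCountable n).ker) :
    ∀ n, IsOpen (((((𝒢.galoisLevelData h36).piPresentation h36.isCountable T R).levelKer hP
        ((𝒢.galoisLevelData h36).projAut h36.isCountable n).ker
        ((𝒢.galoisLevelData h36).hKst_of_hLst_outerAction h36.isCountable (𝒢.galoisLevelData_hconn h36)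
          T R ρ' hP hLst n)).map (outerSemidirectProductSnd ρ') : Subgroup PA) : Set PA) := by
  refine TemperedExtension.isOpen_map_of_frequently (outerSemidirectProductSnd ρ')
    (fun n => ((𝒢.galoisLevelData h36).piPresentation h36.isCountable T R).levelKer hP
      ((𝒢.galoisLevelData h36).projAut h36.isCountable n).ker
      ((𝒢.galoisLevelData h36).hKst_of_hLst_outerAction h36.isCountable (𝒢.galoisLevelData_hconn h36)
        T R ρ' hP hLst n)) (fun m n hmn => ?_) (fun n => ?_)
  · exact ((𝒢.galoisLevelData h36).piPresentation h36.isCountable T R).levelKer_mono hP _ _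
      ((𝒢.galoisLevelData h36).ker_projAut_anti h36.isCountable hmn)
  · exact ⟨max n n₀, le_max_left _ _,
      hK1'_at_of_congruenceContinuous_of_hself h36 hG ρ' baseAct T R hP hLst (max n n₀)
        (hself _ (le_max_right _ _)) (hCC _ (le_max_right _ _))⟩

end ProfiniteSemiGraph

end Literature.AnabelianGeometry.SemiGraphs
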